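import Mathlib
import HarnessLib
import HarnessLib.Audit
import Summits.ValiantsHypothesis.Statement
import Literature.Computability.AlgebraicComplexity.CircuitDepth
import Literature.Computability.AlgebraicComplexity.HomogeneousCircuits
import Literature.Computability.AlgebraicComplexity.HomogeneousDepthFour
import Literature.Computability.AlgebraicComplexity.TavenasDepthFourProofs
import Literature.Computability.AlgebraicComplexity.ValiantConjectureProofs
import Literature.Computability.AlgebraicComplexity.StandardFamiliesProofs
import Summits.ValiantsHypothesis.ValiantsHypothesis.Theorems.SymPencilHubPerNotVp

/-!
Route: Depth4

DORMANT since 2026-09-03T07:28:47Z (reconciler: no traction for 5 d (last activity statement-checked at 2026-08-29T06:46:42Z); parked, not closed — `ledger route dormant route-ValiantsHypothesis-Depth4 --off` to reactivate) — unstaffed, not closed; items shared with open routes are served there. `ledger route dormant <id> --off` reactivates.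

# Route Depth4 — depth reduction — an n^ω(√n) bound for per_n against homogeneous ΣΠΣΠ (depth-4
proper) decides VP_ℂ ≠ VNP_ℂ

It suffices to show X = Depth4Thesis: for every c there is n such that the n×n permanent over ℂ has
no unbounded-fan-in arithmetic
circuit of product-depth ≤ 2 with at most (n+2)^(c⌊√n⌋+c) gates ("per_n needs depth-4 size n^ω(√n)";
gates counted, weighted sums,
constants free; product-depth 2 with free sums = inhomogeneous ΣΠΣΠΣ). REPAIR 2026-08-15
(route-repair planner): the deciding core of X
is its weakest homogeneous shadow Depth4HomFour — the same bound for HOMOGENEOUS ΣΠΣΠ circuits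
proper (Kumar–Saraf's depth-4 discipline
`ArithCircuit.IsDepthFour`, measure `homDepthFourCircuitSize` of HomogeneousDepthFour.lean) —
because Tavenas' reduction lands in exactly
that class and is PROVED in the tree in that measure
(`DepthReduction.homDepthFourCircuitSize_le_of_isVPFamily_complex`). Chain:
Depth4Thesis ⇒ Depth4Homogeneous (hom product-depth 2 = hom ΣΠΣΠΣ) ⇒ Depth4HomFour ⇒ per ∉ VP ⇒ VP_ℂ
≠ VNP_ℂ, each arrow a one-liner
or the deciding theorem. No card is realised (legacy survey route, pre-D-0020).
Lean: `∀ c : ℕ, ∃ n : ℕ, ((n + 2 : ℕ∞) ^ (c * Nat.sqrt n + c)) <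
Literature.Computability.AlgebraicComplexity.productDepthCircuitSize 2
(Literature.Computability.AlgebraicComplexity.perPoly (Fin n) ℂ)`

## Assembly
Deciding theorem (glue.lean, sorry-free, lean check rc 0): `closes (h : Depth4HomFour) :
ValiantsHypothesis`. Were VP ℂ = VNP ℂ, then
per ∈ VP (perFamily_mem_VNP_holds), so (perPoly (Fin n) ℂ)_n is a VP family
(mem_VP_ofFintype_iff_holds); it is homogeneous of degree
n = totalDegree (perPoly_isHomogeneous, totalDegree_perPoly_holds), so Tavenas in the depth-4
measure
(DepthReduction.homDepthFourCircuitSize_le_of_isVPFamily_complex) gives one c with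
homDepthFourCircuitSize (per_n) ≤ (n+2)^(c⌊√n⌋+c) for
all n, contradicting Depth4HomFour at that c. The target and Depth4Homogeneous imply Depth4HomFour
by monotonicity of the three size
measures (productDepthCircuitSize 2 ≤ homProductDepthCircuitSize 2 ≤ homDepthFourCircuitSize). The
item `Assembly` is restated (rev 3) as
`Depth4HomFour → ValiantsHypothesis`, i.e. exactly `closes`; its legacy five-hypothesis form
(Tavenas and deg per_n = n inlined, X, bridge,
per ∈ VNP) stays proved in Theorems/Depth4Assembly.lean.

Rationale: WHY THIS LINE. Depth reduction (AgrawalVinay2008; Koiran; Tavenas2015 Thm 1–2) converts VP ≠ VNP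
into a FINITE-DEPTH lower bound where explicit
complexity measures work: a p-family with poly-size circuits and degree d has homogeneous
ΣΠ^[O(√d)]ΣΠ^[√d] circuits of size n^O(√d), so
"an n^ω(√n) lower bound for just homogeneous depth-4 circuits computing per_n separates VNP from VP"
(KumarSaraf2017 p. 2). The known
engines reach the chasm but not across it: shifted partial derivatives give 2^Ω(√n) for per_n/det_n
at bottom fan-in √n
(GuptaKamathKayalSaptharishi2014 Thm 1–2), random restrictions + projected shifted partials give
n^Ω(√d) against general homogeneous
ΣΠΣΠ for NW and IMM (KayalLimayeSahaSrinivasan2017; KumarSaraf2017 Thm 1.2), and Tavenas is TIGHT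
for IMM ∈ VP in the same measure
(KumarSaraf2017 Cor 1.3), so only the constant in the exponent is missing and any successful measure
must separate per_n from IMM/det.
Imported toolkit: combinatorial commutative algebra (Hilbert functions of derivative ideals,
leading-monomial counts), random restrictions;
belief in X beyond VH itself comes from counting-ETH (DellEtAl2012 = arXiv:1206.1775: no 2^o(n)-time
0/1 permanent under #ETH), since an explicit n^O(√n) depth-4 formula
would be a 2^O(√n·log n) algorithm. What this repair adds over the 2026-08-13 filing and the
negatives index (3 unrelated refutations):
the cruxes now sit on the PRINTED depth-4 measure, on which both Tavenas (proved in tree) and the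
Kumar–Saraf barrier are stated, instead
of the depth-5 product-depth measure for which even n^Ω(√n) is open
(AmireddyGargKayalSahaThankey2023 Open Problem 1.2).

RANKED CRUXES. #0 Depth4Thesis (target) — for every c some n has productDepthCircuitSize 2 (per_n) >
(n+2)^(c⌊√n⌋+c) (inhomogeneous ΣΠΣΠΣ, unbounded fan-in, gates counted) — the headline X; implies
every other lower-bound item of the route. (why it might fail: STRONGER than the deciding crux
(inhomogeneous, bottom sums allowed): false if per_n has (n+2)^(c√n+c)-gate ΣΠΣΠΣ circuits for all
large n; against this model only superpolynomial bounds exist (LST2021 via IMM, low degree); even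
2^Ω(√n) (Depth4GeneralExp) is open.) [Tavenas2015, KumarSaraf2017, LimayeSrinivasanTavenas2021,
GuptaKamathKayalSaptharishi2016, AmireddyGargKayalSahaThankey2023]
#2 Depth4HomFour (crux) — the chasm crossing in the printed model — for every c some n has
(n+2)^(c⌊√n⌋+c) < homDepthFourCircuitSize (per_n): per_n needs homogeneous ΣΠΣΠ circuits (every gate
homogeneous, output in layer ≤ 4 of the Π–Σ–Π–Σ template, bottom products over leaves) of size
n^ω(√n). Weakest statement on the route that decides VH (deciding theorem `closes`). [difficulty:
open-problem] (why it might fail: Needs n^ω(√n) exactly where Tavenas is TIGHT in this measure (IMM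
∈ VP needs n^Ω(√n): KumarSaraf2017 Cor 1.3 = barrier DepthReductionChasmDepthFour): every
hom-ΣΠΣΠ-sound measure VP-saturated at per_n stops at (n+2)^(c√n+c); false outright if per_n has
n^O(√n) hom ΣΠΣΠ circuits (Ryser: n·2^n).) [KumarSaraf2017, Tavenas2015,
GuptaKamathKayalSaptharishi2014, KayalLimayeSahaSrinivasan2017, FournierLimayeMalodSrinivasan2015,
Literature.Barriers.ValiantsHypothesis.DepthReductionChasmDepthFour]
#3 Depth4HomFourSqrt (crux) — parity with IMM for the permanent itself — an n^Ω(√n) lower bound,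
eventually in n, for per_n against homogeneous ΣΠΣΠ circuits with UNBOUNDED bottom fan-in: ∃ c > 0,
n₀ with (n+2)^(⌊√n⌋/c) ≤ homDepthFourCircuitSize (per_n) for all n ≥ n₀. Logically independent of
Depth4HomFour (Ω-everywhere vs ω-somewhere); the first rung whose proof must already make a
restriction-robust measure work on per_n. [difficulty: L] (why it might fail: Open for per_n/det_n:
print has 2^Ω(√n) only at bottom fan-in ≤ √n (GKKS2014 Thm 2) and 2^Ω(n^ε), ε≈1/22, by projection
from IMM (KumarSaraf2017 Cor 1.4); the restriction + projected-shifted-partials count is undone for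
sparse random sub-permanents and may drown in determinantal dependencies.) [KumarSaraf2017,
GuptaKamathKayalSaptharishi2014, KayalLimayeSahaSrinivasan2017, KayalSahaSaptharishi2014,
Saptharishi2021survey]
#9 Depth4Homogeneous (support) — (filed 2026-08-13 as the crux; re-badged support by this repair)
the same ∀c ∃n bound for homogeneous circuits of PRODUCT-depth ≤ 2, i.e. homogeneous ΣΠΣΠΣ (bottom
linear forms allowed; AUDIT in HomogeneousCircuits.lean). Strictly between the target and
Depth4HomFour (homProductDepthCircuitSize 2 ≤ homDepthFourCircuitSize); sufficient for VH via the
proved homogeneous Tavenas fact, but n^Ω(√n) against hom depth-5 is open even for IMM, so it is not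
staffed separately. [difficulty: open-problem] [KumarSaptharishi2017,
AmireddyGargKayalSahaThankey2023, KumarSaraf2017]
#9 Depth4GeneralExp (support) — open stepping stone below X in the inhomogeneous model: ∃ c > 0, n₀
with 2^(⌊√n⌋/c) ≤ productDepthCircuitSize 2 (per_n) for n ≥ n₀ (exp(Ω(√n)) against inhomogeneous
ΣΠΣΠΣ with unbounded fan-in); known there: only superpolynomial bounds (LST2021 + projection from
IMM). [difficulty: open-problem] [LimayeSrinivasanTavenas2021, AmireddyGargKayalSahaThankey2023,
GuptaKamathKayalSaptharishi2016]
#9 Depth4Tavenas (support) — Tavenas' depth reduction for VP families in the product-depth-2 gate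
count (theorem in print, WEAKER than print; DISCHARGED in the tree as
`Literature.Computability.AlgebraicComplexity.productDepthCircuitSize_two_le_of_isVPFamily_holds`,
DepthReductionProofs.lean — a prover closes this item with a one-line term). [difficulty:
provable-now] [Tavenas2015, AgrawalVinay2008]
#9 HubPerNotVp (support) — hub shared by the permanent-based routes: ¬IsVPFamily(per) →
(VP-membership bridge) → per ∈ VNP → ValiantsHypothesis (PROVED in tree: Theorems/HubHub.lean
`Summit.ValiantsHypothesis.Hub.valiantsHypothesis_of_not_isVPFamily_per`). [difficulty:
provable-now] [Valiant1979, Burgisser2000]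

TWO-LAYER PLAN. Foreseen glued splits, filed only after a crux moves: Depth4HomFourSqrt ⇐
RestrictedPerSurvives (w.h.p. the Bernoulli(n^-ε)-zeroed permanent
keeps n^Ω(√n) pairwise-far leading monomials in its projected shifted partials) → PSPDSoundHomFour
(Kumar–Saraf Lemma 4.1-type per-gate
bound for homogeneous ΣΠΣΠ of bottom support ≤ s after restriction, a Literature fact) →
Depth4HomFourSqrt. Depth4HomFour ⇐ NonSaturatedMeasure
(a hom-ΣΠΣΠ-sound PolyMeasure with μ(per_n) > (n+2)^(c√n+c) for every c, i.e. NOT HomVPSaturated at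
per) → Depth4HomFour (pure logic, k = 1+1).

KILL CRITERIA. An explicit family of homogeneous ΣΠΣΠ circuits for per_n with (n+2)^(c⌊√n⌋+c) gates
for one c and all n (¬Depth4HomFour; e.g. a
Ryser/Glynn-type identity of depth four and size n^O(√n)) refutes Depth4HomFour and with it
Depth4Homogeneous and the target — close
`refuted:Depth4HomFour`. ¬Depth4HomFourSqrt (per_n has hom ΣΠΣΠ circuits of size n^o(√n) along a
sequence) does not refute X logically but
kills every restriction-robust measure engine — pivot impossible inside this technique class, close
exhausted. A theorem that every
hom-ΣΠΣΠ-sound RANK measure (rank of a linear image of the coefficient vector) is HomVPSaturated at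
per_n (an unconditional EGOW-type barrier
at depth four) closes the engine; the route would then need a non-rank measure or be retired. VH
proved by any other route moots it.

NOT DECOMPOSED YET. The choice of measure (projected shifted partials under random restrictions;
affine projections of partials; the APP / lopsided
set-multilinear measures of LimayeSrinivasanTavenas2021 and AmireddyGargKayalSahaThankey2023); the
per-versus-det/IMM separation in the
exponent constant (GuptaKamathKayalSaptharishi2014 §8 Conj. 24 is the plain-shifted-partials
instance) — these are layer-2 children of
Depth4HomFour once something moves; the restricted-permanent monomial count (child of
Depth4HomFourSqrt); the strengthenings
Depth4Thesis / Depth4Homogeneous / Depth4GeneralExp (inhomogeneous or depth-5 models) stay recorded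
as target/support and are not staffed;
the formula (VF) and constant-free variants are other routes' business.

CHEAPEST FALSIFIER. Two cheap checks, refuters first. (1) LOOKUP: is an n^O(√n) (= 2^O(√n·log n))
depth-4 formula for per_n in print? Ryser 2^n·n, Glynn 2^(n-1)·n
and Björklund-type 2^(n-Ω(√(n/log n))) are far above, and a uniform one would beat counting-ETH
(DellEtAl2012); a hit refutes Depth4HomFour.
(2) KIT: exact dim SP_{k,ℓ}(per_n) vs SP_{k,ℓ}(det_n) over ℚ for n ≤ 6, k ≤ 2, ℓ ≤ 2 — submitted as
job j002593 (folder kit/spgap.py: ranks mod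
two primes, block-diagonal in the ℤⁿ×ℤⁿ row/column multigrading; `kit compute logs j002593`). A zero
gap everywhere would leave only
restricted/projected variants as engines (cf. EfremenkoLandsbergSchenckWeyman2018, padded model);
the n ≤ 3 smoke test already gives
dim SP_{1,=1}(per_3) = 77 > 65 = dim SP_{1,=1}(det_3) (gap 12 = the alien-cofactor identities Σ_j
x_ij·M_kj = 0, i ≠ k, true for det, false
for per) with SP_{k,=0}, SP_{2,=1} equal (9/9, 45/45): the plain measure is not blind, so (2) does
not kill the engine at the smallest size —
what matters is the growth RATE of the gap against the VP ceiling (GKKS Conj. 24), read off the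
job's n = 4…6 rows.

NUMBERS. Upper bounds for per_n at homogeneous depth four: Ryser's formula is a homogeneous ΣΠΣ ⊂
ΣΠΣΠ formula with 2^n - 1 products of n
linear forms, so homDepthFourCircuitSize (per_n) ≤ (n+1)·2^n (BrualdiRyser1991; Glynn2010 halves
it). Lower bounds in print: 2^Ω(√n)
against ΣΠ^[O(√n)]ΣΠ^[√n] (GuptaKamathKayalSaptharishi2014 Thm 2); 2^Ω(n^ε) with ε > 1/22 against
general homogeneous ΣΠΣΠ via
projection from IMM (KumarSaraf2017 Cor 1.4, stated for det_n; the same projection argument applies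
to the VNP-complete per_n);
n^Ω(√n) for IMM_{n^5,n} ∈ VP and NW families (KumarSaraf2017 Thm 1.2 / 8.10;
KayalLimayeSahaSrinivasan2017). Tavenas in tree:
homDepthFourCircuitSize (f n) ≤ (n+2)^(c⌊√deg⌋+c) with c = 50(a+2)+40 for a VP family of exponent
sum a (TavenasDepthFourProofs.lean).
Needed: > (n+2)^(c⌊√n⌋+c) for EVERY c, infinitely often. Items after repair: 7 (1 target, 2 cruxes,
4 support) + the deciding theorem.

DEFINITION REQUESTS. None outstanding: homProductDepthCircuitSize (defn item of 0330) landed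
(HomogeneousCircuits.lean); homDepthFourCircuitSize,
ArithCircuit.IsDepthFour exist (HomogeneousDepthFour.lean); PolyMeasure / HomVPSaturated exist
(Barriers/DepthReductionChasm*.lean).
Wanted later (layer 2, not filed): a projected-shifted-partials dimension `pspdRank` and a
random-restriction API.

Novelty: Searches (2026-08-13 survey, 2026-08-14 retriage, 2026-08-15 repair): `lit search "homogeneous depth
four arithmetic circuits lower bound
permanent"` (local hits paper:arxiv-1304.5777, paper:doi-10-1145-2629541, paper:doi-10-1145-3689957,
paper:arxiv-2107.09703,
paper:arxiv-2205.00611; crossref doi:10.1109/focs.2008.32, doi:10.1016/j.tcs.2012.03.041,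
doi:10.1109/focs.2014.15, doi:10.1109/focs.2014.46);
`lit frontier ValiantsHypothesis --since 2020` (arXiv:2302.06984, depth reduction for formulas);
`lit read paper:doi-10-1145-3689957`;
2026-08-15: `lit read paper:arxiv-1404.1950 --grep "determinant|permanent"` (p. 4 Cor 1.3 verbatim,
Cor 1.4: Det_n needs 2^Ω(n^ε), ε > 1/22
— confirms n^Ω(√n) for det/per is not claimed); `lit search --hybrid "homogeneous depth four
permanent unbounded bottom fan-in"` and `lit vsearch "n^Ω(√n) for per/det against hom depth-4,
unbounded
bottom fan-in" --papers` (searchd unavailable 16:20Z–16:40Z, D-0023; vsearch 0 docs); `lit galaxy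
search "homogeneous depth 4" --star pdf -n 10` (10 hits:
pdf:3477766987404245300 = KumarSaraf2017 ECCC TR14-045, pdf:7080166046647163960 Kumar–Saraf
locally-low-algebraic-rank CCC 2016,
pdf:2076602273240947740 = EGOW2018 arXiv:1710.09502, pdf:75749279877592380 FLST "On the power of
homogeneous algebraic formulas" ECCC TR23-191
(formulas/VF, read pp. 1–2: not this model), pdf:2481699065344551600 Bhargav–Dutta–Saxena
LST-barrier; none states n^Ω(√n) for per_n/det_n at hom ΣΠΣΠ);
`lit galaxy search "homogeneous depth-4 c  [refs: 10.1109/focs.2008.32, 10.1016/j.tcs.2012.03.041, 10.1109/focs.2014.15, 10.1109/focs.2014.46, 10.1145/2629541, 2302.06984, 1710.09502, 1304.5777, 1404.1950, paper:arxiv-1304.5777, paper:doi-10-1145-2629541, paper:doi-10-1145-3689957, paper:arxiv-2107.09703, paper:arxiv-2205.00611, doi:10.1109/focs.2008.32, doi:10.1016/j.tcs.2012.03.041, doi:10.1109/focs.2014.15, doi:10.1109/focs.2014.46, paper:arxi]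

Barriers (technique_class: depth-four-lower-bounds, shifted-partial-derivatives): - technique_class: depth-four-lower-bounds, shifted-partial-derivatives
- Literature.Barriers.ValiantsHypothesis.DepthReductionChasmDepthFour: APPLIES SQUARELY, not evaded
(KumarSaraf2017 Cor 1.3 as printed, same measure homDepthFourCircuitSize as the cruxes). (i) The
"improve the reduction" half is refuted
(`DepthReductionChasmDepthFour.not_improvedDepthReductionDepthFour`) — the route does not use it;
(ii) every complexity measure sound for homogeneous depth-4 size and HomVPSaturated at per_n with
any slack exponent obeys μ(per_n) ≤ (n+2)^(c√n+c) unconditionally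
(`PolyMeasure.depthFour_chasm_bound_of_vpSaturated`,
`PolyMeasure.not_depthFour_witness_of_vpSaturated`) and cannot witness Depth4HomFour. Honest status:
it does not evade; the bet is a hom-ΣΠΣΠ-sound measure that is NOT VP-saturated at the permanent (it
must beat IMM_{n^5,n} and det_n in the exponent constant) — precisely the undecomposed "choice of
measure".
- Literature.Barriers.ValiantsHypothesis.DepthReductionChasm: the deprecated product-depth-2
(depth-5) rendering of the same barrier; it concerns the support item Depth4Homogeneous only
(`PolyMeasure.not_homDepth4_witness_of_vpSaturated`), same verdict.
- Literature.Barriers.ValiantsHypothesis.ShiftedPartialsCannotSeparate: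
EfremenkoLandsbergSchenckWeyman2018 Thm 1.5 — PADDED model ℓ^(n-m)·per_m vs det_n, n > 2m²+2m; scope
not triggered by depth-4 SIZE bounds for unpadded per_n in its own degree, but it shows the plain
measure saturated by det-type structure:

History (route lifecycle, newest last):
- 2026-08-15T17:07:34Z · rev 3: restated Assembly (stmt-ValiantsHypothesis-0329) — route-repair (g2-0) part 2/2: ADD cruxes Depth4HomFour (#2, deciding; printed depth-4 measure homDepthFourCircuitSize) + Depth4HomFourSqrt (#3, n^Ω(√n) mileston (planner-rbadge-ValiantsHypothesis-Depth4-de297fe4-g2-0)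
- 2026-08-24T06:19:49Z · DORMANT — reconciler: no traction for 6.6 d (last activity item-evidence-added at 2026-08-17T16:00:38Z); parked, not closed — `ledger route dormant route-ValiantsHypothes (operator:999:3654220)
- 2026-08-26T06:33:18Z · REACTIVATED — reconciler: reactivated — activity item-proof-filed at 2026-08-26T05:25:46Z after parking at 2026-08-24T06:19:49Z (operator:999:346067)
- 2026-09-03T07:28:47Z · DORMANT — reconciler: no traction for 5 d (last activity statement-checked at 2026-08-29T06:46:42Z); parked, not closed — `ledger route dormant route-ValiantsHypothesis-D (operator:999:1616629)

sub-problem: ValiantsHypothesis · status: dormant · opened planner-ValiantsHypothesis-Survey-0 2026-08-13T06:08:39Z · rev 8 · ledger route-ValiantsHypothesis-Depth4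
GENERATED by the gate from the ledger (D-0016/17). Provers cite these decls: `theorem foo : Summit.ValiantsHypothesis.ValiantsHypothesis.Theses.Depth4.<Decl> := …` in Summits/ValiantsHypothesis/ValiantsHypothesis/Theorems/<Name>.lean.
-/

namespace Summit.ValiantsHypothesis.ValiantsHypothesis.Theses.Depth4

open scoped BigOperators Topology Manifold Classical MeasureTheory ProbabilityTheory Matrix InnerProductSpace ComplexConjugate ContinuousMap
open Filter Set Function TopologicalSpace MeasureTheory

attribute [summit_statement] _root_.ValiantsHypothesis

open Literature.PNP

/-- item stmt-ValiantsHypothesis-0328 · target · rank 0 · open · by planner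
why it might fail: STRONGER than the deciding crux (inhomogeneous, bottom sums allowed): false if per_n has (n+2)^(c√n+c)-gate ΣΠΣΠΣ circuits for all large n; against this model only superpolynomial bounds exist (LST2021 via IMM, low degree); even 2^Ω(√n) (Depth4GeneralExp) is open.
sources: Tavenas2015, KumarSaraf2017, LimayeSrinivasanTavenas2021, GuptaKamathKayalSaptharishi2016, AmireddyGargKayalSahaThankey2023
For every c some n has productDepthCircuitSize 2 (per_n) > (n+2)^(c⌊√n⌋+c) (unbounded fan-in gates
counted, weighted sums, constants free;
Literature.Computability.AlgebraicComplexity.productDepthCircuitSize from CircuitDepth.lean). Via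
Tavenas2015 depth reduction this suffices for per ∉ VP. Sources: AgrawalVinay2008, Tavenas2015,
GuptaKamathKayalSaptharishi2014, KayalLimayeSahaSrinivasan2017, KumarSaraf2017,
FournierLimayeMalodSrinivasan2015. -/
@[route_item "route-ValiantsHypothesis-Depth4"]
def Depth4Thesis : Prop :=
  ∀ c : ℕ, ∃ n : ℕ, ((n + 2 : ℕ∞) ^ (c * Nat.sqrt n + c)) < Literature.Computability.AlgebraicComplexity.productDepthCircuitSize 2 (Literature.Computability.AlgebraicComplexity.perPoly (Fin n) ℂ)

/-- item stmt-ValiantsHypothesis-11333 · crux · rank 2 · open · by planner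
why it might fail: Needs n^ω(√n) exactly where Tavenas is TIGHT in this measure (IMM ∈ VP needs n^Ω(√n): KumarSaraf2017 Cor 1.3 = barrier DepthReductionChasmDepthFour): every hom-ΣΠΣΠ-sound measure VP-saturated at per_n stops at (n+2)^(c√n+c); false outright if per_n has n^O(√n) hom ΣΠΣΠ circuits (Ryser: n·2^n).
sources: KumarSaraf2017, Tavenas2015, GuptaKamathKayalSaptharishi2014, KayalLimayeSahaSrinivasan2017, FournierLimayeMalodSrinivasan2015, Literature.Barriers.ValiantsHypothesis.DepthReductionChasmDepthFour
[crux] the chasm crossing in the printed model — for every c some n has (n+2)^(c⌊√n⌋+c) <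
homDepthFourCircuitSize (per_n): per_n needs homogeneous ΣΠΣΠ circuits (every gate homogeneous,
output in layer ≤ 4 of the Π–Σ–Π–Σ template, bottom products over leaves) of size n^ω(√n). Weakest
statement on the route that decides VH (deciding theorem `closes`). [difficulty: open-problem] -/
@[route_item "route-ValiantsHypothesis-Depth4"]
def Depth4HomFour : Prop :=
  ∀ c : ℕ, ∃ n : ℕ, ((n + 2 : ℕ∞) ^ (c * Nat.sqrt n + c)) < Literature.Computability.AlgebraicComplexity.homDepthFourCircuitSize (Literature.Computability.AlgebraicComplexity.perPoly (Fin n) ℂ)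

/-- item stmt-ValiantsHypothesis-0317 · support · rank 1 · closed · proved by Summit.ValiantsHypothesis.ValiantsHypothesis.Theorems.hubPerNotVp_proof @ 8fd72a57f796 (prover) · by planner
sources: in tree: Summits/ValiantsHypothesis/ValiantsHypothesis/Theorems/HubHub.lean (valiantsHypothesis_of_not_isVPFamily_per), BurgisserClausenShokrollahi1997 p.575 Prop 21.15, p.577 (21.19); Valiant1979
Hub lemma shared by all permanent-based routes: if the permanent family over ℂ is not a VP family
then VP ℂ ≠ VNP ℂ, given the renaming bridge (mem_VP_ofFintype_iff instance) and per ∈ VNP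
[Valiant1979; Burgisser2000 Thm 2.10]. Trivial bookkeeping; land once in
Summits/ValiantsHypothesis/Theorems/Hub/. -/
@[route_item "route-ValiantsHypothesis-Depth4"]
def HubPerNotVp : Prop :=
  ¬ Literature.Computability.AlgebraicComplexity.IsVPFamily (fun n => Literature.Computability.AlgebraicComplexity.perPoly (Fin n) ℂ) → (Literature.Computability.AlgebraicComplexity.perFamily ℂ ∈ Literature.Computability.AlgebraicComplexity.VP ℂ ↔ Literature.Computability.AlgebraicComplexity.IsVPFamily (fun n => Literature.Computability.AlgebraicComplexity.perPoly (Fin n) ℂ)) → Literature.Computability.AlgebraicComplexity.perFamily_mem_VNP ℂ → ValiantsHypothesis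

/-- `HubPerNotVp` holds: proved by `Summit.ValiantsHypothesis.ValiantsHypothesis.Theorems.hubPerNotVp_proof` @ 8fd72a57f796. -/
theorem HubPerNotVp_holds : HubPerNotVp := _root_.Summit.ValiantsHypothesis.ValiantsHypothesis.Theorems.hubPerNotVp_proof

/-- item stmt-ValiantsHypothesis-0330 · support · rank 2 · open · by planner
why it might fail: Needs n^ω(√n) exactly where Tavenas' n^O(√d) is TIGHT for hom ΣΠΣΠ (IMM ∈ VP needs n^Ω(√d): KumarSaraf2017 Cor 1.3, FLMS2015): every hom-depth-4-sound measure VP-saturated at per_n (shifted/projected partials) stops at (n+2)^(c√n+c); false outright if per_n has n^O(√n) hom ΣΠΣΠΣ circuits.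
sources: KumarSaraf2017 (arXiv:1404.1950) Thm 1.1-1.2, Cor 1.3, §10 open problems, FournierLimayeMalodSrinivasan2015 Thm 1 (IMM, bounded bottom fan-in; tightness), GuptaKamathKayalSaptharishi2014 = doi:10.1145/2629541 Thm 1-2 (2^{Ω(√n)} for per_n/det_n vs ΣΠ^[O(√n)]ΣΠ^[√n]) and §7 Prop 21 (limitation of shifted partials), §8 Conj 24, Tavenas2015 (arXiv:1304.5777) Thm 1 ('if f is homogeneous, so is C'), Thm 2, p.11 Thm 3, KayalLimayeSahaSrinivasan2017 (n^{Ω(√d)} vs hom ΣΠΣΠ over char 0, NW/IMM families), Literature.Barriers.ValiantsHypothesis.DepthReductionChasm (PolyMeasure.not_homDepth4_witness_of_vpSaturated; DepthReductionChasm.not_improvedDepthReduction)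
[needs_definition: homProductDepthCircuitSize] Informal (needs def
`Literature.Computability.AlgebraicComplexity.homProductDepthCircuitSize Δ f : ℕ∞` = least size of a
circuit of product-depth ≤ Δ computing f in which every gate computes a homogeneous polynomial; and
`ArithCircuit.IsHomogeneousCircuit`). Crux: ∀ c ∃ n, homProductDepthCircuitSize 2 (perPoly (Fin n)
ℂ) > (n+2)^(c⌊√n⌋+c). This is exactly the model output by Tavenas2015 (hom. ΣΠ^[O(√d)]ΣΠ^[√d] of
size 2^(O(√d log s))), so it suffices for per ∉ VP. Known: 2^(Ω(√n)) for per_n/det_n against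
ΣΠ^[O(√n)]ΣΠ^[√n] [GuptaKamathKayalSaptharishi2014]; n^(Ω(√d)) against general homogeneous ΣΠΣΠ for
IMM and Nisan–Wigderson families [KayalLimayeSahaSrinivasan2017, KumarSaraf2017] — for per_n itself
with unbounded bottom fan-in an n^(Ω(√n)) bound is, to my knowledge, open and is the first
sub-milestone. Barrier: the same n^(Ω(√d)) holds for IMM ∈ VBP [FournierLimayeMalodSrinivasan2015],
matching Tavenas, so the measure must separate per from IMM. -/
@[route_item "route-ValiantsHypothesis-Depth4"]
def Depth4Homogeneous : Prop :=
  ∀ c : ℕ, ∃ n : ℕ, ((n + 2 : ℕ∞) ^ (c * Nat.sqrt n + c)) < Literature.Computability.AlgebraicComplexity.homProductDepthCircuitSize 2 (Literature.Computability.AlgebraicComplexity.perPoly (Fin n) ℂ)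

/-- item stmt-ValiantsHypothesis-0331 · support · rank 3 · open · by planner
Open stepping stone between the known and X_Depth4: an exp(√n/c) lower bound for per_n against
inhomogeneous ΣΠΣΠ with unbounded fan-in over ℂ. Consistent with the depth-3 chasm
[GuptaKamathKayalSaptharishi2016] (which gives n^(O(√n)) upper bounds at product-depth 1 only for VP
members). Known in this generality: superpolynomial n^(Ω(√log n))-type bounds via
[LimayeSrinivasanTavenas2021] + projection from IMM. Techniques: LST lopsided set-multilinear
projections of per, APP measure. -/
@[route_item "route-ValiantsHypothesis-Depth4"]
def Depth4GeneralExp : Prop :=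
  ∃ c : ℕ, 0 < c ∧ ∃ n₀ : ℕ, ∀ n ≥ n₀, ((2 : ℕ∞) ^ (Nat.sqrt n / c)) ≤ Literature.Computability.AlgebraicComplexity.productDepthCircuitSize 2 (Literature.Computability.AlgebraicComplexity.perPoly (Fin n) ℂ)

/-- item stmt-ValiantsHypothesis-11334 · aside · rank 3 · open · by planner
why it might fail: Open for per_n/det_n: print has 2^Ω(√n) only at bottom fan-in ≤ √n (GKKS2014 Thm 2) and 2^Ω(n^ε), ε≈1/22, by projection from IMM (KumarSaraf2017 Cor 1.4); the restriction + projected-shifted-partials count is undone for sparse random sub-permanents and may drown in determinantal dependencies.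
sources: KumarSaraf2017, GuptaKamathKayalSaptharishi2014, KayalLimayeSahaSrinivasan2017, KayalSahaSaptharishi2014, Saptharishi2021survey
[crux] parity with IMM for the permanent itself — an n^Ω(√n) lower bound, eventually in n, for per_n
against homogeneous ΣΠΣΠ circuits with UNBOUNDED bottom fan-in: ∃ c > 0, n₀ with (n+2)^(⌊√n⌋/c) ≤
homDepthFourCircuitSize (per_n) for all n ≥ n₀. Logically independent of Depth4HomFour (Ω-everywhere
vs ω-somewhere); the first rung whose proof must already make a restriction-robust measure work on
per_n. [difficulty: L] -/
@[route_item "route-ValiantsHypothesis-Depth4"]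
def Depth4HomFourSqrt : Prop :=
  ∃ c : ℕ, 0 < c ∧ ∃ n₀ : ℕ, ∀ n ≥ n₀, ((n + 2 : ℕ∞) ^ (Nat.sqrt n / c)) ≤ Literature.Computability.AlgebraicComplexity.homDepthFourCircuitSize (Literature.Computability.AlgebraicComplexity.perPoly (Fin n) ℂ)

/-- item stmt-ValiantsHypothesis-0332 · support · rank 4 · closed · proved by Summit.ValiantsHypothesis.ValiantsHypothesis.Theorems.Depth4.depth4Tavenas_proof (prover) · by planner
Theorem in print [Tavenas2015 Thm 1; AgrawalVinay2008; Koiran]: a family with fan-in-2 circuits of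
size s(n) and degree d(n) has homogeneous ΣΠ^[O(√d)]ΣΠ^[√d] circuits with 2^(O(√d·log(ds))) gates;
for a VP family this is ≤ (n+2)^(c√d + c). Stated for the unbounded-fan-in gate count
productDepthCircuitSize 2 (general ⊇ homogeneous). Expected to become a Literature fact; hypothesis
of depth4_assembly. Check small-n/degree-0 edge cases are absorbed by (n+2)^c. -/
@[route_item "route-ValiantsHypothesis-Depth4"]
def Depth4Tavenas : Prop :=
  ∀ {σ : ℕ → Type} [∀ n, Fintype (σ n)] (f : ∀ n, MvPolynomial (σ n) ℂ), Literature.Computability.AlgebraicComplexity.IsVPFamily f → ∃ c : ℕ, ∀ n : ℕ, Literature.Computability.AlgebraicComplexity.productDepthCircuitSize 2 (f n) ≤ ((n + 2 : ℕ∞) ^ (c * Nat.sqrt ((f n).totalDegree) + c))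

-- `Depth4Tavenas` holds: proved by `Summit.ValiantsHypothesis.ValiantsHypothesis.Theorems.Depth4.depth4Tavenas_proof` (its module imports this route file, so no `_holds` link can be stated here).

-- earlier Assembly (stmt-ValiantsHypothesis-0329, replaced 2026-08-15T17:07:34Z -> stmt-ValiantsHypothesis-11332): retired by None — (∀ {σ : ℕ → Type} [∀ n, Fintype (σ n)] (f : ∀ n, MvPolynomial (σ n) ℂ), Literature.Computability.AlgebraicComplexity.IsVPFamily f → ∃ c : ℕ, ∀ n : ℕ, Literature.Computability.AlgebraicComplexity.productDepthCircuitSize 2 (f n) ≤ ((n + 2 : ℕ∞) ^ (c * Nat.sqrt ((f n).tot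
/-- item stmt-ValiantsHypothesis-11332 · assembly · rank 1 · closed · proved by Summit.ValiantsHypothesis.ValiantsHypothesis.Theorems.Depth4.assembly_proof (prover) · by planner
[assembly] Depth4HomFour → ValiantsHypothesis: the deciding theorem `closes` (glue.lean) proves
exactly this — VP = VNP ⇒ per ∈ VP (perFamily_mem_VNP_holds, mem_VP_ofFintype_iff_holds) ⇒ Tavenas
in the printed depth-4 measure (DepthReduction.homDepthFourCircuitSize_le_of_isVPFamily_complex,
with perPoly_isHomogeneous and totalDegree_perPoly_holds) bounds homDepthFourCircuitSize per_n by
(n+2)^(c⌊√n⌋+c) for one c and all n, contradicting Depth4HomFour at that c. Restated 2026-08-15 from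
the legacy five-hypothesis form (Tavenas, deg per_n = n, X, bridge, per ∈ VNP → VH; that form stays
proved in Theorems/Depth4Assembly.lean). -/
@[route_item "route-ValiantsHypothesis-Depth4"]
def Assembly : Prop :=
  Depth4HomFour → _root_.ValiantsHypothesis

-- `Assembly` holds: proved by `Summit.ValiantsHypothesis.ValiantsHypothesis.Theorems.Depth4.assembly_proof` (its module imports this route file, so no `_holds` link can be stated here).

/-! D-0027 §2.1 — DECIDING THEOREM (planner-authored via `route open/edit --closes-file`; by planner-rbadge-ValiantsHypothesis-Depth4-de297fe4-g2-0 2026-08-15T17:07:34Z):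
its hypotheses are this route's items and its conclusion the sub-problem Statement (glue_lint), and it elaborates with this file. -/

@[closes "route-ValiantsHypothesis-Depth4"] theorem closes (h_Depth4HomFour : Depth4HomFour) : _root_.ValiantsHypothesis := by
  show Literature.Computability.AlgebraicComplexity.VP ℂ ≠ Literature.Computability.AlgebraicComplexity.VNP ℂ
  intro hEq
  have hVNP := Literature.Computability.AlgebraicComplexity.perFamily_mem_VNP_holds ℂ
  have hVP : Literature.Computability.AlgebraicComplexity.perFamily ℂ ∈
      Literature.Computability.AlgebraicComplexity.VP ℂ := by rw [hEq]; exact hVNP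
  have hfam : Literature.Computability.AlgebraicComplexity.IsVPFamily
      (fun n => Literature.Computability.AlgebraicComplexity.perPoly (Fin n) ℂ) :=
    (Literature.Computability.AlgebraicComplexity.mem_VP_ofFintype_iff_holds _).1 hVP
  have hdeg : ∀ n : ℕ, (Literature.Computability.AlgebraicComplexity.perPoly (Fin n) ℂ).totalDegree = n := by
    intro n
    rw [Literature.Computability.AlgebraicComplexity.totalDegree_perPoly_holds (n := Fin n) (k := ℂ), Fintype.card_fin]
  have hhom : ∀ n : ℕ, (Literature.Computability.AlgebraicComplexity.perPoly (Fin n) ℂ).IsHomogeneous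
      (Literature.Computability.AlgebraicComplexity.perPoly (Fin n) ℂ).totalDegree := by
    intro n
    rw [hdeg n]
    simpa only [Fintype.card_fin] using
      (Literature.Computability.AlgebraicComplexity.perPoly_isHomogeneous (n := Fin n) (k := ℂ))
  obtain ⟨c, hc⟩ :=
    Literature.Computability.AlgebraicComplexity.DepthReduction.homDepthFourCircuitSize_le_of_isVPFamily_complex
      (fun n => Literature.Computability.AlgebraicComplexity.perPoly (Fin n) ℂ) hfam hhom
  obtain ⟨n, hn⟩ := h_Depth4HomFour c
  have h := hc n
  rw [hdeg n] at h
  exact absurd (lt_of_lt_of_le hn h) (lt_irrefl _)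

end Summit.ValiantsHypothesis.ValiantsHypothesis.Theses.Depth4
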